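import Mathlib
import Summits.ValiantsHypothesis.ValiantsHypothesis.Theorems.NewtonUnitEquationsNewtonTauWeakAutomatonGenDefs

/-!
# `NewtonUnitEquationsNewtonTauWeakAutomatonGenRecursion` — general carry automaton: bilinear self-similarity

Rung toward `NewtonTauWeak` (stmt-ValiantsHypothesis-5904), line `binomial-normal-form`, THEOREM B (general carry
automaton, level polynomials of degree `≤ C` per variable): registered stub `stub_genRecursion`, the verbatim
generalisation of `stub_autoRecursion` (`…AutomatonRecursion.lean`, digit hexagon) from the states `Fin 2 × Fin 2` to
the states `GSt C = Fin (C+1) × Fin (C+1)` and from three binomials per level to an arbitrary level polynomial.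

Claim.  Reading the levels `[0, h+m)` of the position `P = 2^h H + L` (`L` in the low box `[0, 2^h)²`) is reading
the levels `[0, h)` of `L` and then the levels `[0, m)` of `H` with the level polynomials shifted by `h`:
as matrices `N^{[0,h+m)}(P) = N^{[0,h)}(L) · N^{[h,h+m)}(P) = N_low(L) · N_high(H)`, and `genContract k C` applied to
the Kronecker product `high ⊗ low` is by definition the vector of entries of the blockwise products `N_low · N_high`.

Proof.  `List.range' 0 (h+m) = List.range' 0 h ++ List.range' h m` splits the ordered product (`genN_split`); the
low factor only reads binary digits below `h`, which are those of `L` (`Nat.testBit_two_pow_mul_add`, `genN_low`);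
the high factor reads the digits `h+i`, `i < m`, which are the digits `i` of `H` (`genN_high`, reindexing
`List.range' h m = (List.range m).map (h + ·)`).  Then unfold `genContract`, `genVecFin`, `genVec` at an index
`gidxEquiv k C (l, κ, κ'')` and recognise `Matrix.mul_apply`. [folklore: carry automaton / transfer matrices of
digit expansions]
-/

set_option linter.dupNamespace false

noncomputable section

open scoped BigOperators

namespace Summit.ValiantsHypothesis.ValiantsHypothesis.Theorems.NewtonTauWeakAutomaton

namespace GenRecursionAux

/-- Splitting the levels: the ordered product over `[0, h+m)` is the product over `[0, h)` times the product
over `[h, h+m)`. [folklore] -/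
theorem genN_split (C : ℕ) (G : ℕ → MvPolynomial (Fin 2) ℂ) (h m : ℕ) (P : ℕ × ℕ) :
    genN C G 0 (h + m) P = genN C G 0 h P * genN C G h m P := by
  unfold genN
  rw [← List.range'_append_1, Nat.zero_add, List.map_append, List.prod_append]

/-- The low factor of `P = 2^h H + L` (`L` in the low box) only reads the digits of `L`. [folklore] -/
theorem genN_low (C : ℕ) (G : ℕ → MvPolynomial (Fin 2) ℂ) (h : ℕ) (H L : ℕ × ℕ)
    (hL : L.1 < 2 ^ h ∧ L.2 < 2 ^ h) :
    genN C G 0 h (2 ^ h * H.1 + L.1, 2 ^ h * H.2 + L.2) = genN C G 0 h L := by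
  unfold genN
  congr 1
  apply List.map_congr_left
  intro i hi
  rw [List.mem_range'_1] at hi
  have hi' : i < h := by omega
  dsimp only
  rw [Nat.testBit_two_pow_mul_add _ hL.1, Nat.testBit_two_pow_mul_add _ hL.2, if_pos hi', if_pos hi']

/-- The high factor of `P = 2^h H + L` (`L` in the low box) reads the digits of `H`, with the level polynomials
shifted by `h`. [folklore] -/
theorem genN_high (C : ℕ) (G : ℕ → MvPolynomial (Fin 2) ℂ) (h m : ℕ) (H L : ℕ × ℕ)
    (hL : L.1 < 2 ^ h ∧ L.2 < 2 ^ h) :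
    genN C G h m (2 ^ h * H.1 + L.1, 2 ^ h * H.2 + L.2) = genN C (fun i => G (i + h)) 0 m H := by
  unfold genN
  rw [List.range'_eq_map_range, List.range'_eq_map_range, List.map_map, List.map_map]
  congr 1
  apply List.map_congr_left
  intro i _
  simp only [Function.comp_apply, Nat.zero_add]
  rw [Nat.testBit_two_pow_mul_add _ hL.1, Nat.testBit_two_pow_mul_add _ hL.2, if_neg (by omega),
    if_neg (by omega), Nat.add_sub_cancel_left, Nat.add_comm h i]

end GenRecursionAux

open GenRecursionAux in
/-- **Bilinear self-similarity of the general carry-automaton configuration (Theorem B).**  The configuration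
vector over the levels `[0, h+m)` at the position `2^h H + L` (`L` in the low box `[0, 2^h)²`) is the contraction
`genContract k C` of the Kronecker product of the level-`[0, m)` configuration at `H` with the level polynomials
shifted by `h` (high digits) and the level-`[0, h)` configuration at `L` (low digits): blockwise,
`N^{[0,h+m)}(2^h H + L) = N_low(L) · N_high(H)`. [folklore: carry automaton / transfer matrices of digit expansions] -/
theorem stub_genRecursion (k C h m : ℕ) (G : Fin k → ℕ → MvPolynomial (Fin 2) ℂ) (H L : ℕ × ℕ)
    (hL : L.1 < 2 ^ h ∧ L.2 < 2 ^ h) :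
    genVecFin k C G 0 (h + m) (2 ^ h * H.1 + L.1, 2 ^ h * H.2 + L.2) =
      genContract k C (fun ij => genVecFin k C (shiftLev G h) 0 m H (finProdFinEquiv.symm ij).1 *
        genVecFin k C G 0 h L (finProdFinEquiv.symm ij).2) := by
  funext j
  obtain ⟨i, rfl⟩ : ∃ i, j = gidxEquiv k C i := ⟨(gidxEquiv k C).symm j, by simp⟩
  obtain ⟨l, κ, κ''⟩ := i
  simp only [genContract, LinearMap.coe_mk, AddHom.coe_mk, genVecFin, genVec, Equiv.symm_apply_apply]
  rw [genN_split, genN_low C (G l) h H L hL, genN_high C (G l) h m H L hL, Matrix.mul_apply]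
  exact Finset.sum_congr rfl fun κ' _ => mul_comm _ _

end Summit.ValiantsHypothesis.ValiantsHypothesis.Theorems.NewtonTauWeakAutomaton

end
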